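/-
Origin: expansion seat `planner-pub-hodgecm-toy-g3-0`, handover #4 v2 2026-08-18T11:46:57Z (`HOME/pub-hodgecm-toy-g3/lean/ToyG3/DescentFacts3.lean`, md5 d0c3e03e, 477 lines);
landed by the gen-8 packager in gate run 29 as `HodgeCM/Model/ToyG2/DescentFacts3.lean` (import ^import ToyG3\.CupFacts3[ \t]*$→import HodgeCM.Model.ToyG2.CupFacts3 ×1).
-/
/-
Copyright: pub-hodgecm formalisation cell (harness21, 2026). New file (not vendored).
Origin: session planner-pub-hodgecm-toy-g3-0 (unit pub-hodgecm-toy-g3, EXPANSION part (e) CONSISTENCY WITNESS, gen 3 of the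
lineage toy → toy-g2 → toy-g3), 2026-08-18.  WIP module `ToyG3.DescentFacts3`; intended final place
`HodgeCM/Model/ToyG2/DescentFacts3.lean` (module `HodgeCM.Model.ToyG2.DescentFacts3`; kind L5, toy model / consistency witness —
ONE NEW ADDITIVE FILE, no landed file is touched).  Its one WIP import `ToyG3.CupFacts3` ↦ `HodgeCM.Model.ToyG2.CupFacts3`;
the other imports are FINAL package names (in the tree since gate run 27).
-/
import Mathlib
import Summits.HodgeConjecture.HodgeCM.Model.ToyG2.CupFacts3
import Summits.HodgeConjecture.HodgeCM.Model.Toy.ToyUnitH0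
import Summits.HodgeConjecture.HodgeCM.Model.ToyG2.ThetaModel3
import Summits.HodgeConjecture.HodgeCM.StubTree.Qw8NoN3

/-!
# The trace-free [QW8] inputs F4, F5, F-H0, F7d, F7d-B, `Fact_dimProd` in the generation-2 toy universe — and the
# COMPLETE binder list of `Assembly.COR_CM_of_descentFactsB₄` in ONE model, realisation included

The [QW8]-side end-to-end theorem with the fewest geometric inputs is, since gate run 28,
`Assembly.COR_CM_of_descentFactsB₄ : ModelAxioms → RealisationExistsFace → N1 → N2 → F4 → F5 → F-H0 → F7d-B → Fact_dimProd → HC_CM`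
(`HodgeCM/StubTree/Qw8NoN3.lean`; TEN binders).  Generation 1 witnessed the nine GENERIC binders jointly in
`toyModel` (`HodgeCM.Toy.descentFactsB_consistent`, `Model/Toy/ToyUnitH0.lean`; `HodgeCM.Toy.descentFacts_consistent`,
`Model/Toy/ToyGysinDescent.lean`) — but there the geometric binder `RealisationExistsFace` is FALSE (trace zero,
`HodgeCM.Toy.toyModel_openInputs_iff`), so the ten were never shown jointly satisfiable.  In toy-g2's universe
`toyUniverse₃ d t` (`1 ≤ d`, `t² = 16`) the face realisation EXISTS (`HodgeCM.ToyG2.ThetaUiso.realisationExistsFace₃`,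
pv03-g5).  This file ports the generic binders to `toyModel3With exteriorHodgeData T pl` (every trace system `T`, every
good block assignment `pl`) and assembles the ten:

* `fact3_cupAssoc D T pl` (F5, any Hodge datum), `fact3_cupAlg T pl` (F4), `fact3_dimProd D T pl` (`Fact_dimProd`),
  `fact3_unitH0 D T pl` (F-H0), `fact3_pull_H0_cmProd D T pl` — no hypothesis;
* `fact3_gysinDescent T pl M` (F7d, both clauses) and `fact3_gysinDescentB T pl M` (F7d-B), GIVEN the model axioms `M`
  of the universe (used through the kernel theorems `Universe.boxC_ne_zero_succ` / `Universe.pullC_top_ne_zero` /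
  `Universe.finrank_coh_one_cmProd`, exactly as generation 1 used `toyModel_modelAxioms`); the proof is generation 1's
  (`HodgeCM.Toy.GysinWitness`, qw8-g4) run at the expanded objects `X.X.toObj`, whose bigraded bookkeeping
  (`Obj.FF`, `Obj.GG`, `Obj.Θ`) is reused BY NAME;
* `toyUniverse₃_descentFactsB₄ d t hd ht M` — the TEN binders of `COR_CM_of_descentFactsB₄` in `toyUniverse₃ d t`;
  `toyUniverse₃_descentFacts₄ d t hd ht M` — the ten of `COR_CM_of_descentFacts₄` (F7d form);
  `toyUniverse₃_descentProfile d t hd ht M` — everything at once (both realisations, N1–N4, F4, F5, F-H0, F7d, F7d-B,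
  `Fact_dimProd`, `Fact_pull_H0_cmProd`); `toyUniverse₃_hcCM_by_descentB₄` — the end-to-end theorem RUN on the model;
* `exists_descentFactsB₄_inputs_of_gysin (h26 : (toyUniverse₃ 1 4).Fact_gysin_surface)` — the joint witness
  `∃ U, ModelAxioms ∧ RealisationExistsFace ∧ N1 ∧ N2 ∧ F4 ∧ F5 ∧ F-H0 ∧ F7d-B ∧ Fact_dimProd` modulo the one displayed
  model axiom M26 (discharged in `HodgeCM.Model.ToyG2.DescentFactsAll3` from pv03-g6's `SplitAllGood`, as for
  `OpenInputsAll3`).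

WHAT THIS SHOWS / DOES NOT SHOW.  The complete hypothesis set of the trace-free [QW8] route is satisfiable by one explicit
structure with a nonempty face realisation, so that route's end-state theorem is not vacuously true and none of its ten
inputs is refutable from the others.  As in generation 1, `HC_CM` itself is trivial in the model (`alg =` Hodge classes);
the content is in the binders.  Nothing is said about complex projective varieties.  Everything is kernel-proved from the
tree; no citation, nothing posited.  Heartbeats (package policy `CONTRIBUTING.md` §3: ≤ 400000, with reason): four
declarations run at 400000 — `theta_boxC₃` (generation-1 original: 800000) and the three pieces `wedge_map_add₃`,
`descent_b₃_sum_mem_FF`, `descent_b₃_wedge_eq_zero` into which generation 1's single 1600000-heartbeat declaration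
`HodgeCM.Toy.GysinWitness.descent_b` (landed `Model/Toy/ToyGysinDescent.lean`) has been cut; everything else runs at the
default.  The cost is `isDefEq`/`whnf` on the model's structure projections unfolded at the CM products (measured: the
single generic rewrite `map_add` under `⋀ (p_{Y,ℂ})` alone exceeds 200000), not the mathematics.
-/

noncomputable section

open scoped TensorProduct
open exteriorPower Module
open Literature.AlgebraicGeometry.Motives
open Literature.AlgebraicGeometry.Motives.HodgeStructure (ofRat ofRat_apply mem_hodgeClasses_iff)

namespace HodgeCM.ToyG2

open HodgeCM.Toy

variable (D : HodgeData) (T : TraceSys) (pl : GBlocks)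

/-! ### F5 — associativity of the cup product (any Hodge datum) -/

/-- degree transport does not change the underlying element of the exterior algebra -/
lemma coe_castCoh₃ (X : GObj) {k l : ℕ} (h : k = l) (z : (toyModel3With D T pl).Coh X k) :
    (((toyModel3With D T pl).castCoh X h z : ⋀[ℚ]^l X.X.L) : ExteriorAlgebra ℚ X.X.L) =
      ((z : ⋀[ℚ]^k X.X.L) : ExteriorAlgebra ℚ X.X.L) := by
  subst h; rfl

/-- **F5 in `toyModel3With D T pl`**: `(a ∪ b) ∪ c = a ∪ (b ∪ c)` up to degree transport (`∪ = ∧` is the associative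
multiplication of `⋀ L`; generation 1: `HodgeCM.Toy.fact_cupAssoc`). -/
theorem fact3_cupAssoc : (toyModel3With D T pl).Fact_cupAssoc := by
  intro X i j k a b c
  apply Subtype.ext
  rw [coe_castCoh₃]
  show (((a : ⋀[ℚ]^i X.X.L) : ExteriorAlgebra ℚ X.X.L) * (b : ⋀[ℚ]^j X.X.L)) * (c : ⋀[ℚ]^k X.X.L) =
    ((a : ⋀[ℚ]^i X.X.L) : ExteriorAlgebra ℚ X.X.L) * ((b : ⋀[ℚ]^j X.X.L) * (c : ⋀[ℚ]^k X.X.L))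
  exact mul_assoc _ _ _

/-! ### F4 — algebraic classes are closed under cup product (exterior Hodge datum) -/

/-- membership of a degree-transported class in `alg^r` is membership of `1 ⊗ z` in `F^r` -/
lemma castCoh₃_mem_alg_iff (X : GObj) {k r : ℕ} (h : k = 2 * r) (z : (toyModel3With D T pl).Coh X k) :
    (toyModel3With D T pl).castCoh X h z ∈ (toyModel3With D T pl).alg X r ↔
      ofRat z ∈ (D.hs X.X.toObj k).F (r : ℤ) := by
  subst h; exact mem_hodgeClasses_iff _ _ _

/-- **F4 in `toyModel3With exteriorHodgeData T pl`**: `alg^p ∪ alg^q ⊆ alg^{p+q}`, from N2 `fact3_cup_hodge`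
(generation 1: `HodgeCM.Toy.fact_cupAlg`). -/
theorem fact3_cupAlg : (toyModel3With exteriorHodgeData T pl).Fact_cupAlg := by
  intro X p q x y hx hy
  rw [castCoh₃_mem_alg_iff]
  have hx' : ofRat x ∈ (exteriorHodgeData.hs X.X.toObj (2 * p)).F (p : ℤ) := (mem_hodgeClasses_iff _ _ _).mp hx
  have hy' : ofRat y ∈ (exteriorHodgeData.hs X.X.toObj (2 * q)).F (q : ℤ) := (mem_hodgeClasses_iff _ _ _).mp hy
  have hc := fact3_cup_hodge T pl X (2 * p) (2 * q) (p : ℤ) (q : ℤ) (ofRat x) (ofRat y) hx' hy'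
  rw [Toy.ofRat_eq, Toy.ofRat_eq, Universe.cupC_tmul, mul_one] at hc
  rw [Toy.ofRat_eq]
  push_cast
  exact hc

/-! ### `Fact_dimProd` and F-H0 (any Hodge datum) -/

/-- **`Fact_dimProd` in `toyModel3With D T pl`**: the generation-2 dimension is additive by definition
(`Obj₂.dim_prod`). -/
theorem fact3_dimProd : (toyModel3With D T pl).Fact_dimProd := fun X Y => Obj₂.dim_prod X.X Y.X

/-- **F-H0 in `toyModel3With D T pl`**: unit classes `1_X = ιMulti ℚ 0 ![] ∈ ⋀⁰ L_X` (generation 1: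
`HodgeCM.Toy.fact_unitH0`, same three computations). -/
theorem fact3_unitH0 : (toyModel3With D T pl).Fact_unitH0 := by
  refine ⟨fun X => ιMulti ℚ 0 ![], ?_, ?_, ?_⟩
  · intro X Y f
    show exteriorPower.map 0 f.lin (ιMulti ℚ 0 ![]) = ιMulti ℚ 0 ![]
    rw [map_apply_ιMulti]
    congr 1
    exact Subsingleton.elim _ _
  · intro X l z
    apply Subtype.ext
    show ((wedge ℚ X.X.L 0 l (ιMulti ℚ 0 ![]) z : ⋀[ℚ]^(0 + l) X.X.L) : ExteriorAlgebra ℚ X.X.L) =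
      (((toyModel3With D T pl).castCoh X (Nat.zero_add l).symm z : ⋀[ℚ]^(0 + l) X.X.L) : ExteriorAlgebra ℚ X.X.L)
    rw [wedge_coe, ιMulti_apply_coe, ExteriorAlgebra.ιMulti_zero_apply, one_mul, coe_castCoh₃]
  · intro F n Θ e
    have hsp : e ∈ Submodule.span ℚ (Set.range (ιMulti ℚ 0 (M := ((toyModel3With D T pl).cmProd F Θ).X.L))) := by
      rw [ιMulti_span]; exact Submodule.mem_top
    have hrange : Set.range (ιMulti ℚ 0 (M := ((toyModel3With D T pl).cmProd F Θ).X.L)) = {ιMulti ℚ 0 ![]} := by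
      ext z
      simp only [Set.mem_range, Set.mem_singleton_iff]
      constructor
      · rintro ⟨v, rfl⟩; rw [Subsingleton.elim v ![]]
      · rintro rfl; exact ⟨_, rfl⟩
    rw [hrange, Submodule.mem_span_singleton] at hsp
    obtain ⟨r, hr⟩ := hsp
    exact ⟨r, hr.symm⟩

/-- `Fact_pull_H0_cmProd` (N3 at CM products) in `toyModel3With D T pl`, from N3 `fact3_pull_H0`. -/
theorem fact3_pull_H0_cmProd : (toyModel3With D T pl).Fact_pull_H0_cmProd :=
  Universe.fact_pull_H0_cmProd_of_pull_H0 (fact3_pull_H0 D T pl)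

/-! ### F7d — trace-free Gysin descent (exterior Hodge datum, given the model axioms) -/

namespace GysinWitness₃

variable {T pl}

/-- `Θ ∘ (f^*)_ℂ = ⋀^k f_ℂ ∘ Θ` (generation 1 `GysinWitness.theta_pullC` at the underlying morphism `f.hom`) -/
theorem theta_pullC₃ {X Y : GObj} (f : Obj₂.Hom₂ X.X Y.X) (k : ℕ) (x : (toyModel3With D T pl).CohC Y k) :
    X.X.toObj.Θ k ((toyModel3With D T pl).pullC f k x) = exteriorPower.map k (f.lin.baseChange ℂ) (Y.X.toObj.Θ k x) :=
  Toy.GysinWitness.theta_pullC D f.hom k x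

/-- shorthand for the generation-2 exterior CM-model (reducible) -/
abbrev TM₃ (T : TraceSys) (pl : GBlocks) : Universe := toyModel3With exteriorHodgeData T pl

/-- `2 dim A′ = #Idx A′` for a CM product (from the model axioms: `finrank_coh_one_cmProd`, `two_mul_dim_cmProd_of_dimProd`) -/
theorem two_mul_dim_eq_card₃ (M : (TM₃ T pl).ModelAxioms) (F : CMField) {m : ℕ} (Θ' : Fin (m + 1) → CMType F) :
    2 * (TM₃ T pl).dim ((TM₃ T pl).cmProd F Θ') = Fintype.card ((TM₃ T pl).cmProd F Θ').X.toObj.Idx := by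
  have h1 := Universe.finrank_coh_one_cmProd M F Θ'
  change Module.finrank ℚ ↥(⋀[ℚ]^1 ((TM₃ T pl).cmProd F Θ').X.toObj.L) = _ at h1
  haveI : Module.Free ℚ ((TM₃ T pl).cmProd F Θ').X.toObj.L := Module.Free.of_divisionRing ℚ _
  rw [exteriorPower.finrank_eq, Nat.choose_one_right] at h1
  rw [Universe.two_mul_dim_cmProd_of_dimProd M (fact3_dimProd _ T pl) F Θ', Toy.GysinWitness.card_Idx, h1]

/-- `nhol univ = dim A′` -/
theorem nhol_univ_eq_dim₃ (M : (TM₃ T pl).ModelAxioms) (F : CMField) {m : ℕ} (Θ' : Fin (m + 1) → CMType F) :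
    ((TM₃ T pl).cmProd F Θ').X.toObj.nhol Finset.univ = (TM₃ T pl).dim ((TM₃ T pl).cmProd F Θ') := by
  have h := two_mul_nhol_univ ((TM₃ T pl).cmProd F Θ').X.toObj
  rw [← two_mul_dim_eq_card₃ M] at h
  omega

section Witness

variable {F : CMField} {n m : ℕ} (Ξ : Fin (n + 1 + (m + 1)) → CMType F)
  {pA : (TM₃ T pl).Mor ((TM₃ T pl).cmProd F Ξ) ((TM₃ T pl).cmProd F (blkA Ξ))}
  {pB : (TM₃ T pl).Mor ((TM₃ T pl).cmProd F Ξ) ((TM₃ T pl).cmProd F (blkB Ξ))}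

/-- `1 ⊗ x ≠ 0` for `x ≠ 0` -/
theorem ofRat_ne_zero₃ {X : GObj} {k : ℕ} {x : (TM₃ T pl).Coh X k} (hx : x ≠ 0) : (ofRat x : (TM₃ T pl).CohC X k) ≠ 0 :=
  fun h => hx (Universe.one_tmul_injective (h.trans (TensorProduct.tmul_zero _ (1 : ℂ)).symm))

/-- **(a) in positive degree**: the kernel theorem `Universe.boxC_ne_zero_succ`, complexified back. -/
theorem descent_a_succ₃ (M : (TM₃ T pl).ModelAxioms) (hP : (TM₃ T pl).IsBlockPair F Ξ pA pB)
    {ω : (TM₃ T pl).Coh ((TM₃ T pl).cmProd F (blkB Ξ)) (2 * (TM₃ T pl).dim ((TM₃ T pl).cmProd F (blkB Ξ)))}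
    (hω : ω ≠ 0) {k : ℕ} {e : (TM₃ T pl).Coh ((TM₃ T pl).cmProd F (blkA Ξ)) (k + 1)}
    (he : (TM₃ T pl).cup ((TM₃ T pl).cmProd F Ξ) (k + 1) _ ((TM₃ T pl).pull pA (k + 1) e) ((TM₃ T pl).pull pB _ ω) = 0) :
    e = 0 := by
  by_contra hne
  apply Universe.boxC_ne_zero_succ Ξ M (fact3_cupExterior exteriorHodgeData T pl) (fact3_cupAssoc _ T pl)
    (fact3_dimProd _ T pl) hP (ofRat_ne_zero₃ hne) (ofRat_ne_zero₃ hω)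
  rw [ofRat_apply, ofRat_apply, Universe.pullC_tmul, Universe.pullC_tmul, Universe.cupC_tmul, mul_one, he,
    TensorProduct.tmul_zero]

/-- **(a) in degree 0**: `H⁰(Y) = ⋀⁰ L = ℚ · 1`, `(r · 1) ∧ z = r · z`, and `p_{Y'}^* ω ≠ 0` (`pullC_top_ne_zero`). -/
theorem descent_a_zero₃ (M : (TM₃ T pl).ModelAxioms) (hP : (TM₃ T pl).IsBlockPair F Ξ pA pB)
    {ω : (TM₃ T pl).Coh ((TM₃ T pl).cmProd F (blkB Ξ)) (2 * (TM₃ T pl).dim ((TM₃ T pl).cmProd F (blkB Ξ)))}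
    (hω : ω ≠ 0) {e : (TM₃ T pl).Coh ((TM₃ T pl).cmProd F (blkA Ξ)) 0}
    (he : (TM₃ T pl).cup ((TM₃ T pl).cmProd F Ξ) 0 _ ((TM₃ T pl).pull pA 0 e) ((TM₃ T pl).pull pB _ ω) = 0) : e = 0 := by
  have hB : (TM₃ T pl).pull pB _ ω ≠ 0 := by
    intro h0
    apply Universe.pullC_top_ne_zero Ξ M (fact3_cupExterior exteriorHodgeData T pl) (fact3_dimProd _ T pl) hP
      (ofRat_ne_zero₃ hω)
    rw [ofRat_apply, Universe.pullC_tmul, h0, TensorProduct.tmul_zero]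
  have hsp : e ∈ Submodule.span ℚ (Set.range (ιMulti ℚ 0 (M := ((TM₃ T pl).cmProd F (blkA Ξ)).X.L))) := by
    rw [ιMulti_span]; exact Submodule.mem_top
  have hrange : Set.range (ιMulti ℚ 0 (M := ((TM₃ T pl).cmProd F (blkA Ξ)).X.L)) = {ιMulti ℚ 0 ![]} := by
    ext z
    simp only [Set.mem_range, Set.mem_singleton_iff]
    constructor
    · rintro ⟨v, rfl⟩; rw [Subsingleton.elim v ![]]
    · rintro rfl; exact ⟨_, rfl⟩
  rw [hrange, Submodule.mem_span_singleton] at hsp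
  obtain ⟨r, rfl⟩ := hsp
  have hpull : (TM₃ T pl).pull pA 0 (r • ιMulti ℚ 0 ![]) = r • ιMulti ℚ 0 ![] := by
    show exteriorPower.map 0 pA.lin (r • ιMulti ℚ 0 ![]) = _
    rw [map_smul, map_apply_ιMulti]
    congr 2
    exact Subsingleton.elim _ _
  have hc : (r • (1 : ExteriorAlgebra ℚ ((TM₃ T pl).cmProd F Ξ).X.L)) * ((TM₃ T pl).pull pB _ ω).val = 0 := by
    refine Eq.trans ?_ ((congrArg Subtype.val he).trans (ZeroMemClass.coe_zero _))
    rw [hpull]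
    show _ = (wedge ℚ ((TM₃ T pl).cmProd F Ξ).X.L 0 _ (r • ιMulti ℚ 0 ![]) ((TM₃ T pl).pull pB _ ω)).val
    rw [wedge_coe, Submodule.coe_smul, ιMulti_apply_coe, ExteriorAlgebra.ιMulti_zero_apply]
  rw [smul_mul_assoc, one_mul, smul_eq_zero] at hc
  rcases hc with hc | hc
  · rw [hc, zero_smul]
  · exact absurd (ZeroMemClass.coe_eq_zero.mp hc) hB

set_option maxHeartbeats 400000 in -- unfolding the structure projections at the CM products (generation 1: 800000)
/-- `Θ (p_Y^* x ∪ p_{Y'}^* w) = ⋀ p_{Y,ℂ} (Θ x) ∧ ⋀ p_{Y',ℂ} (Θ w)` -/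
theorem theta_boxC₃ (i j : ℕ) (x : (TM₃ T pl).CohC ((TM₃ T pl).cmProd F (blkA Ξ)) i)
    (w : (TM₃ T pl).CohC ((TM₃ T pl).cmProd F (blkB Ξ)) j) :
    ((TM₃ T pl).cmProd F Ξ).X.toObj.Θ (i + j)
        ((TM₃ T pl).cupC ((TM₃ T pl).cmProd F Ξ) i j ((TM₃ T pl).pullC pA i x) ((TM₃ T pl).pullC pB j w)) =
      wedge ℂ ((TM₃ T pl).cmProd F Ξ).X.toObj.LC i j
        (exteriorPower.map i (pA.lin.baseChange ℂ) (((TM₃ T pl).cmProd F (blkA Ξ)).X.toObj.Θ i x))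
        (exteriorPower.map j (pB.lin.baseChange ℂ) (((TM₃ T pl).cmProd F (blkB Ξ)).X.toObj.Θ j w)) := by
  rw [← theta_pullC₃ exteriorHodgeData pA i x, ← theta_pullC₃ exteriorHodgeData pB j w]
  exact theta_cupC exteriorHodgeData ((TM₃ T pl).cmProd F Ξ).X.toObj i j _ _

set_option maxHeartbeats 400000 in -- `isDefEq` of `⋀ (p_{Y,ℂ})` against the complexified lattice of the unfolded CM product (200000 is insufficient, tested)
/-- additivity of `f ↦ ⋀ p_{Y,ℂ} f ∧ ⋀ p_{Y',ℂ} (Θ ω)` (isolated, so that no rewrite has to search a large hypothesis) -/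
theorem wedge_map_add₃
    {ω : (TM₃ T pl).Coh ((TM₃ T pl).cmProd F (blkB Ξ)) (2 * (TM₃ T pl).dim ((TM₃ T pl).cmProd F (blkB Ξ)))}
    (p : ℕ) (f g : ⋀[ℂ]^(2 * p) ((TM₃ T pl).cmProd F (blkA Ξ)).X.toObj.LC) :
    wedge ℂ ((TM₃ T pl).cmProd F Ξ).X.toObj.LC (2 * p) (2 * (TM₃ T pl).dim ((TM₃ T pl).cmProd F (blkB Ξ)))
        (exteriorPower.map (2 * p) (pA.lin.baseChange ℂ) (f + g))
        (exteriorPower.map _ (pB.lin.baseChange ℂ) (((TM₃ T pl).cmProd F (blkB Ξ)).X.toObj.Θ _ (ofRat ω))) =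
      wedge ℂ ((TM₃ T pl).cmProd F Ξ).X.toObj.LC _ _ (exteriorPower.map (2 * p) (pA.lin.baseChange ℂ) f)
          (exteriorPower.map _ (pB.lin.baseChange ℂ) (((TM₃ T pl).cmProd F (blkB Ξ)).X.toObj.Θ _ (ofRat ω))) +
        wedge ℂ ((TM₃ T pl).cmProd F Ξ).X.toObj.LC _ _ (exteriorPower.map (2 * p) (pA.lin.baseChange ℂ) g)
          (exteriorPower.map _ (pB.lin.baseChange ℂ) (((TM₃ T pl).cmProd F (blkB Ξ)).X.toObj.Θ _ (ofRat ω))) := by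
  rw [(exteriorPower.map (2 * p) (pA.lin.baseChange ℂ)).map_add f g]
  exact LinearMap.map_add₂ _ _ _ _

set_option maxHeartbeats 400000 in -- rewriting `he` along `theta_boxC₃` at the unfolded CM products (200000 is insufficient, tested)
/-- **(b), step 1a** — `Θ` of the box product, distributed over `Θ e = f + g`: if `p_Y^* e ∪ p_{Y'}^* ω ∈ Alg^{p+d'}(P)`
then `⋀ p_{Y,ℂ} f ∧ ⋀ p_{Y',ℂ} (Θ ω) + ⋀ p_{Y,ℂ} g ∧ ⋀ p_{Y',ℂ} (Θ ω) ∈ FF^{p+d'}(P)` (`theta_boxC₃`). -/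
theorem descent_b₃_sum_mem_FF
    {ω : (TM₃ T pl).Coh ((TM₃ T pl).cmProd F (blkB Ξ)) (2 * (TM₃ T pl).dim ((TM₃ T pl).cmProd F (blkB Ξ)))}
    (p : ℕ) (e : (TM₃ T pl).Coh ((TM₃ T pl).cmProd F (blkA Ξ)) (2 * p))
    (he : (TM₃ T pl).castCoh ((TM₃ T pl).cmProd F Ξ)
      (by omega : 2 * p + 2 * (TM₃ T pl).dim ((TM₃ T pl).cmProd F (blkB Ξ)) =
        2 * (p + (TM₃ T pl).dim ((TM₃ T pl).cmProd F (blkB Ξ))))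
      ((TM₃ T pl).cup ((TM₃ T pl).cmProd F Ξ) (2 * p) _ ((TM₃ T pl).pull pA (2 * p) e) ((TM₃ T pl).pull pB _ ω)) ∈
        (TM₃ T pl).alg ((TM₃ T pl).cmProd F Ξ) (p + (TM₃ T pl).dim ((TM₃ T pl).cmProd F (blkB Ξ))))
    {f g : ⋀[ℂ]^(2 * p) ((TM₃ T pl).cmProd F (blkA Ξ)).X.toObj.LC}
    (hfg : f + g = ((TM₃ T pl).cmProd F (blkA Ξ)).X.toObj.Θ (2 * p) (ofRat e)) :
    wedge ℂ ((TM₃ T pl).cmProd F Ξ).X.toObj.LC _ _ (exteriorPower.map (2 * p) (pA.lin.baseChange ℂ) f)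
        (exteriorPower.map _ (pB.lin.baseChange ℂ) (((TM₃ T pl).cmProd F (blkB Ξ)).X.toObj.Θ _ (ofRat ω))) +
      wedge ℂ ((TM₃ T pl).cmProd F Ξ).X.toObj.LC _ _ (exteriorPower.map (2 * p) (pA.lin.baseChange ℂ) g)
        (exteriorPower.map _ (pB.lin.baseChange ℂ) (((TM₃ T pl).cmProd F (blkB Ξ)).X.toObj.Θ _ (ofRat ω))) ∈
      ((TM₃ T pl).cmProd F Ξ).X.toObj.FF (2 * p + 2 * (TM₃ T pl).dim ((TM₃ T pl).cmProd F (blkB Ξ)))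
        ((p : ℤ) + (TM₃ T pl).dim ((TM₃ T pl).cmProd F (blkB Ξ))) := by
  rw [castCoh₃_mem_alg_iff] at he
  change ofRat _ ∈ ((TM₃ T pl).cmProd F Ξ).X.toObj.hodgeF _ _ at he
  rw [Obj.mem_hodgeF] at he
  have hbox : (ofRat ((TM₃ T pl).cup ((TM₃ T pl).cmProd F Ξ) (2 * p) _ ((TM₃ T pl).pull pA (2 * p) e)
      ((TM₃ T pl).pull pB _ ω)) :
      (TM₃ T pl).CohC ((TM₃ T pl).cmProd F Ξ) (2 * p + 2 * (TM₃ T pl).dim ((TM₃ T pl).cmProd F (blkB Ξ)))) =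
        (TM₃ T pl).cupC ((TM₃ T pl).cmProd F Ξ) (2 * p) _ ((TM₃ T pl).pullC pA (2 * p) (ofRat e))
          ((TM₃ T pl).pullC pB _ (ofRat ω)) := by
    rw [ofRat_apply, ofRat_apply, ofRat_apply, Universe.pullC_tmul, Universe.pullC_tmul, Universe.cupC_tmul,
      mul_one]
  rw [hbox, theta_boxC₃ (pA := pA) (pB := pB) Ξ (2 * p) (2 * (TM₃ T pl).dim ((TM₃ T pl).cmProd F (blkB Ξ)))
    (ofRat e) (ofRat ω), ← hfg, wedge_map_add₃ (pA := pA) (pB := pB) Ξ p f g, Nat.cast_add] at he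
  exact he

set_option maxHeartbeats 400000 in -- six `FF`/`GG` memberships at the unfolded CM products (200000 is insufficient, tested)
/-- **(b), step 1b** — generation 1's bigraded bookkeeping `FF ∧ FF ⊆ FF`, `GG ∧ GG ⊆ GG`, `FF ∩ GG = 0` at the expanded
objects: with `f ∈ FF^{p}`, `g ∈ GG^{p}` and the sum of step 1a in `FF^{p+d'}(P)`, `⋀ p_{Y,ℂ} g ∧ ⋀ p_{Y',ℂ} (Θ ω) = 0`. -/
theorem descent_b₃_wedge_eq_zero (M : (TM₃ T pl).ModelAxioms)
    {ω : (TM₃ T pl).Coh ((TM₃ T pl).cmProd F (blkB Ξ)) (2 * (TM₃ T pl).dim ((TM₃ T pl).cmProd F (blkB Ξ)))}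
    (p : ℕ) {f g : ⋀[ℂ]^(2 * p) ((TM₃ T pl).cmProd F (blkA Ξ)).X.toObj.LC}
    (hf : f ∈ ((TM₃ T pl).cmProd F (blkA Ξ)).X.toObj.FF (2 * p) p)
    (hg : g ∈ ((TM₃ T pl).cmProd F (blkA Ξ)).X.toObj.GG (2 * p) p)
    (hsum : wedge ℂ ((TM₃ T pl).cmProd F Ξ).X.toObj.LC _ _ (exteriorPower.map (2 * p) (pA.lin.baseChange ℂ) f)
        (exteriorPower.map _ (pB.lin.baseChange ℂ) (((TM₃ T pl).cmProd F (blkB Ξ)).X.toObj.Θ _ (ofRat ω))) +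
      wedge ℂ ((TM₃ T pl).cmProd F Ξ).X.toObj.LC _ _ (exteriorPower.map (2 * p) (pA.lin.baseChange ℂ) g)
        (exteriorPower.map _ (pB.lin.baseChange ℂ) (((TM₃ T pl).cmProd F (blkB Ξ)).X.toObj.Θ _ (ofRat ω))) ∈
      ((TM₃ T pl).cmProd F Ξ).X.toObj.FF (2 * p + 2 * (TM₃ T pl).dim ((TM₃ T pl).cmProd F (blkB Ξ)))
        ((p : ℤ) + (TM₃ T pl).dim ((TM₃ T pl).cmProd F (blkB Ξ)))) :
    wedge ℂ ((TM₃ T pl).cmProd F Ξ).X.toObj.LC _ _ (exteriorPower.map (2 * p) (pA.lin.baseChange ℂ) g)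
      (exteriorPower.map _ (pB.lin.baseChange ℂ) (((TM₃ T pl).cmProd F (blkB Ξ)).X.toObj.Θ _ (ofRat ω))) = 0 := by
  have hcard : Fintype.card ((TM₃ T pl).cmProd F (blkB Ξ)).X.toObj.Idx = 2 * (TM₃ T pl).dim ((TM₃ T pl).cmProd F (blkB Ξ)) :=
    (two_mul_dim_eq_card₃ M F (blkB Ξ)).symm
  have hnhol : (((TM₃ T pl).cmProd F (blkB Ξ)).X.toObj.nhol Finset.univ : ℤ) =
      (TM₃ T pl).dim ((TM₃ T pl).cmProd F (blkB Ξ)) := by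
    exact_mod_cast nhol_univ_eq_dim₃ M F (blkB Ξ)
  obtain ⟨hωF, hωG⟩ := Toy.GysinWitness.top_mem_FF_GG _ hcard (((TM₃ T pl).cmProd F (blkB Ξ)).X.toObj.Θ _ (ofRat ω))
  rw [hnhol] at hωF hωG
  have hAf : exteriorPower.map (2 * p) (pA.lin.baseChange ℂ) f ∈ ((TM₃ T pl).cmProd F Ξ).X.toObj.FF (2 * p) p :=
    Obj.FF_map_le pA.hom _ _ ⟨f, hf, rfl⟩
  have hAg : exteriorPower.map (2 * p) (pA.lin.baseChange ℂ) g ∈ ((TM₃ T pl).cmProd F Ξ).X.toObj.GG (2 * p) p :=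
    Toy.GysinWitness.GG_map_le pA.hom _ _ ⟨g, hg, rfl⟩
  have hBF : exteriorPower.map _ (pB.lin.baseChange ℂ) (((TM₃ T pl).cmProd F (blkB Ξ)).X.toObj.Θ _ (ofRat ω)) ∈
      ((TM₃ T pl).cmProd F Ξ).X.toObj.FF (2 * (TM₃ T pl).dim ((TM₃ T pl).cmProd F (blkB Ξ)))
        ((TM₃ T pl).dim ((TM₃ T pl).cmProd F (blkB Ξ))) :=
    Obj.FF_map_le pB.hom _ _ ⟨_, hωF, rfl⟩
  have hBG : exteriorPower.map _ (pB.lin.baseChange ℂ) (((TM₃ T pl).cmProd F (blkB Ξ)).X.toObj.Θ _ (ofRat ω)) ∈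
      ((TM₃ T pl).cmProd F Ξ).X.toObj.GG (2 * (TM₃ T pl).dim ((TM₃ T pl).cmProd F (blkB Ξ)))
        (((TM₃ T pl).dim ((TM₃ T pl).cmProd F (blkB Ξ)) : ℤ) + 1) :=
    Toy.GysinWitness.GG_map_le pB.hom _ _ ⟨_, hωG, rfl⟩
  have hFF := ((TM₃ T pl).cmProd F Ξ).X.toObj.wedge_mem_FF _ _ _ _ hAf hBF
  have hGG : wedge ℂ ((TM₃ T pl).cmProd F Ξ).X.toObj.LC _ _ (exteriorPower.map (2 * p) (pA.lin.baseChange ℂ) g)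
      (exteriorPower.map _ (pB.lin.baseChange ℂ) (((TM₃ T pl).cmProd F (blkB Ξ)).X.toObj.Θ _ (ofRat ω))) ∈
        ((TM₃ T pl).cmProd F Ξ).X.toObj.GG (2 * p + 2 * (TM₃ T pl).dim ((TM₃ T pl).cmProd F (blkB Ξ)))
          ((p : ℤ) + (TM₃ T pl).dim ((TM₃ T pl).cmProd F (blkB Ξ))) := by
    have h := Toy.GysinWitness.wedge_mem_GG _ _ _ _ _ hAg hBG
    rwa [show (p : ℤ) + (((TM₃ T pl).dim ((TM₃ T pl).cmProd F (blkB Ξ)) : ℤ) + 1) - 1 =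
        p + (TM₃ T pl).dim ((TM₃ T pl).cmProd F (blkB Ξ)) by ring] at h
  have hGF : wedge ℂ ((TM₃ T pl).cmProd F Ξ).X.toObj.LC _ _ (exteriorPower.map (2 * p) (pA.lin.baseChange ℂ) g)
      (exteriorPower.map _ (pB.lin.baseChange ℂ) (((TM₃ T pl).cmProd F (blkB Ξ)).X.toObj.Θ _ (ofRat ω))) ∈
        ((TM₃ T pl).cmProd F Ξ).X.toObj.FF (2 * p + 2 * (TM₃ T pl).dim ((TM₃ T pl).cmProd F (blkB Ξ)))
          ((p : ℤ) + (TM₃ T pl).dim ((TM₃ T pl).cmProd F (blkB Ξ))) := by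
    have h' := Submodule.sub_mem _ hsum hFF
    rwa [add_sub_cancel_left] at h'
  exact Submodule.disjoint_def.mp (((TM₃ T pl).cmProd F Ξ).X.toObj.disjoint_FF_GG _ _) _ hGF hGG

/-- **(b), step 2** — a `GG^{p}`-class `g` of degree `2p` on `Y` with `⋀ p_{Y,ℂ} g ∧ ⋀ p_{Y',ℂ} (Θ ω) = 0` vanishes:
`GG⁰ = 0` in degree `0`, and (a)_ℂ = the kernel theorem `Universe.boxC_ne_zero_succ` in positive degree. -/
theorem descent_b₃_g_eq_zero (M : (TM₃ T pl).ModelAxioms) (hP : (TM₃ T pl).IsBlockPair F Ξ pA pB)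
    {ω : (TM₃ T pl).Coh ((TM₃ T pl).cmProd F (blkB Ξ)) (2 * (TM₃ T pl).dim ((TM₃ T pl).cmProd F (blkB Ξ)))}
    (hω : ω ≠ 0) (p : ℕ) {g : ⋀[ℂ]^(2 * p) ((TM₃ T pl).cmProd F (blkA Ξ)).X.toObj.LC}
    (hg : g ∈ ((TM₃ T pl).cmProd F (blkA Ξ)).X.toObj.GG (2 * p) p)
    (hzero : wedge ℂ ((TM₃ T pl).cmProd F Ξ).X.toObj.LC _ _ (exteriorPower.map (2 * p) (pA.lin.baseChange ℂ) g)
      (exteriorPower.map _ (pB.lin.baseChange ℂ) (((TM₃ T pl).cmProd F (blkB Ξ)).X.toObj.Θ _ (ofRat ω))) = 0) :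
    g = 0 := by
  rcases Nat.eq_zero_or_pos p with hp | hp
  · subst hp
    have hbot : ((TM₃ T pl).cmProd F (blkA Ξ)).X.toObj.GG (2 * 0) ((0 : ℕ) : ℤ) = ⊥ := Obj.GG_eq_bot _ le_rfl
    rw [hbot] at hg
    exact hg
  · obtain ⟨k, hk⟩ : ∃ k, 2 * p = k + 1 := ⟨2 * p - 1, by omega⟩
    by_contra hg0
    have hx0 : (((TM₃ T pl).cmProd F (blkA Ξ)).X.toObj.Θ (2 * p)).symm g ≠ 0 := fun h =>
      hg0 ((LinearEquiv.map_eq_zero_iff _).mp h)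
    have hx1 : (TM₃ T pl).castC ((TM₃ T pl).cmProd F (blkA Ξ)) hk
        ((((TM₃ T pl).cmProd F (blkA Ξ)).X.toObj.Θ (2 * p)).symm g) ≠ 0 := fun h =>
      hx0 ((LinearEquiv.map_eq_zero_iff _).mp h)
    apply Universe.boxC_ne_zero_succ Ξ M (fact3_cupExterior exteriorHodgeData T pl) (fact3_cupAssoc _ T pl)
      (fact3_dimProd _ T pl) hP hx1 (ofRat_ne_zero₃ hω)
    rw [Universe.pullC_castC, Universe.cupC_castC_left, LinearEquiv.map_eq_zero_iff,
      ← LinearEquiv.map_eq_zero_iff (((TM₃ T pl).cmProd F Ξ).X.toObj.Θ (2 * p + 2 * (TM₃ T pl).dim ((TM₃ T pl).cmProd F (blkB Ξ)))),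
      theta_boxC₃, LinearEquiv.apply_symm_apply]
    exact hzero


-- port_pkg: scope closed for this part
end Witness
end GysinWitness₃
end HodgeCM.ToyG2
end
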